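import Literature.AlgebraicGeometry.Motives.JacobianHomology
import Literature.AlgebraicGeometry.Motives.AbelianVarietyIsogenyCovering
import Literature.AlgebraicGeometry.Motives.AlgebraicLift
import Literature.AlgebraicTopology.FundamentalGroup.PowerCommutingCovering
import Literature.AlgebraicTopology.FundamentalGroup.HOneCoveringHom
import Literature.AlgebraicTopology.FundamentalGroup.MapOfEqRange
import Literature.GroupTheory.Index.SquaresSupFiniteIndex
import HarnessLib

/-!
# `(f^P)_* π₁(C(ℂ))` has finite index in `π₁(J(ℂ))` for the Jacobian of a curve

For a smooth projective curve `C/ℂ`, a Jacobian `𝒥` of `C` (the tree's universal-property structure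
`Jacobian C`, Milne, *Jacobian Varieties*, Prop. 6.4) and `P ∈ C(ℂ)`, the image of
`π₁(C(ℂ), P)` under the Abel–Jacobi map `f^P : C → J` has **finite index** in `π₁(J(ℂ), 1)`
(`Jacobian.index_range_map_abelJacobi_ne_zero`). Classically this is read off from
`J(ℂ) = H⁰(ω_C)^*/H₁(C, ℤ)` — `α_{c*} : H₁(C, ℤ) → H₁(J, ℤ)` is even bijective (Lange, *Abelian
Varieties over the Complex Numbers* (2023), §4.1.1 and Lemma 4.4.1). Here it is proved for the
ABSTRACT Jacobian from its universal property alone, by covering-space theory: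

Let `Λ = π₁(J(ℂ), 1)`, `M = (f^P)_* π₁(C(ℂ), P)`, `χ : Λ → J[2](ℂ)ᵒᵖ` the monodromy of the étale
double-and-more covering `[2] : J(ℂ) → J(ℂ)` (`AbelianVarietyFundamentalGroup.lean`), `S = χ(M)`,
`J'' = J/S` the quotient abelian variety with quotient isogeny `h : J → J''`
(`AbelianVarietyIsogenyCovering.lean`, Mumford §7 Thm. 4). Then `h_*(M) ⊆ ([2]_{J''})_* π₁(J''(ℂ))`
(`PowerCommutingCovering.lean`), so `h ∘ f^P` lifts continuously through the covering `[2]` of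
`J''(ℂ)` (Hatcher Prop. 1.33), and the lift is ALGEBRAIC, `g : C → J''` with `[2] ∘ g = h ∘ f^P`
(`AlgebraicLift.lean`: `[2]_{J''}` is étale). By the universal property (`Jacobian.descPointed`,
`hom_ext_abelJacobi`; Milne Prop. 6.1) `g = ψ ∘ f^P` and `[2] ∘ ψ = h` for a homomorphism
`ψ : J → J''`, whence `h_* Λ ⊆ 2 Λ''`, so `|S| = [Λ'' : h_* Λ] ≥ [Λ'' : 2Λ''] = |J''[2](ℂ)| = 2^{b₁(J'')}
≥ 2^{b₁(J)} = |J[2](ℂ)| ≥ |S|` (`TopologicalGroupCovering.lean`, `AbelianVarietyFundamentalGroup.lean`,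
`HOneCoveringHom.lean`), i.e. `S = J[2](ℂ)`: `M` maps ONTO `Λ/Λ²`, and a subgroup of the finitely
generated abelian group `Λ ≅ H₁(J(ℂ); ℤ)` with `M Λ² = Λ` has finite index
(`SquaresSupFiniteIndex.lean`).

With `JacobianHomology.lean` this reduces the named fact `isIso_bettiCohomology_map_abelJacobi`
(`(f^P)^* : H¹(J(ℂ); ℚ) ≅ H¹(C(ℂ); ℚ)`) to the inequality of Betti numbers `b₁(C) ≤ b₁(J)`
(`isIso_bettiCohomology_map_abelJacobi_of_finrank_le`), i.e. to `dim J = g`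
(`isIso_bettiCohomology_map_abelJacobi_of_facts`: the named facts
`two_mul_dim_eq_finrank_bettiCohomology` and `AbelianVariety.natCard_torsionPoints_of_isAlgClosed`).
Everything here is proved; no definitions, no new named facts.

## References

* H. Lange, *Abelian Varieties over the Complex Numbers* (2023), §4.1.1, Lemma 4.4.1.
  [Lange2023AbelianVarietiesC]
* J. S. Milne, *Jacobian Varieties* (1986), §2, Prop. 6.1, Prop. 6.4. [Milne1986JacobianVarieties]
* A. Hatcher, *Algebraic Topology* (2002), §1.3 Prop. 1.31–1.40. [HatcherAT2002]
* D. Mumford, *Abelian Varieties* (1970), §7 Thm. 4. [MumfordAV1970]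
-/

noncomputable section

open CategoryTheory AlgebraicGeometry Function
open Literature.AlgebraicTopology.FundamentalGroup Literature.AlgebraicTopology.SingularHomology
open Literature.GroupTheory.Index

namespace Literature.AlgebraicGeometry.Motives

open scoped MonObj

/-! ### The complex points of a smooth projective curve -/

/-- `X(ℂ)` is locally path connected for `X` smooth projective (a topological manifold).
[cite: SerreGAGA1956, §2 n°5 Prop. 2 and n°6] -/
theorem IsSmoothProjective.locallyPathConnectedSpace {n : ℕ} {X : SchemeOver ℂ}
    (hX : IsSmoothProjective n X) : LocallyPathConnectedSpace (ComplexPoints X) :=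
  letI := hX.chartedSpace
  ChartedSpace.locallyPathConnectedSpace (H := EuclideanSpace ℝ (Fin (2 * n))) (M := ComplexPoints X)

/-- `X(ℂ)` is path connected for `X` smooth projective (connected, SGA1 XII Prop. 2.4, and locally path
connected). [cite: SGA1, Exp. XII Prop. 2.4] -/
theorem IsSmoothProjective.pathConnectedSpace {n : ℕ} {X : SchemeOver ℂ}
    (hX : IsSmoothProjective n X) : PathConnectedSpace (ComplexPoints X) :=
  haveI := Literature.AlgebraicGeometry.HodgeTheory.connectedSpace_complexPoints hX
  haveI := hX.locallyPathConnectedSpace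
  pathConnectedSpace_iff_connectedSpace.2 inferInstance

/-! ### Auxiliary facts -/

/-- Ranges of `mapOfEq` along equal continuous maps agree. [folklore] -/
theorem range_mapOfEq_congr {X Y : Type*} [TopologicalSpace X] [TopologicalSpace Y] {f g : C(X, Y)}
    (hfg : f = g) {x : X} {y : Y} (hf : f x = y) :
    (FundamentalGroup.mapOfEq f hf).range = (FundamentalGroup.mapOfEq g (hfg ▸ hf)).range := by
  subst hfg
  rfl

/-- `C ×_{J''} J''` (pull-back of `[2]`) is a Noetherian topological space: finite over the proper
`C`. [folklore] -/
theorem noetherianSpace_pullback_of_isFinite {C Y S : SchemeOver ℂ} (f : C ⟶ S) (g : Y ⟶ S)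
    [IsProper C.hom] [IsFinite g.left] : TopologicalSpace.NoetherianSpace ↥(Limits.pullback f.left g.left) := by
  haveI : CompactSpace ↥C.left := by
    haveI : QuasiCompact C.hom := inferInstance
    exact QuasiCompact.compactSpace_of_compactSpace C.hom
  haveI : CompactSpace ↥(Limits.pullback f.left g.left) :=
    QuasiCompact.compactSpace_of_compactSpace (Limits.pullback.fst f.left g.left)
  haveI : IsLocallyNoetherian (Limits.pullback f.left g.left) :=
    LocallyOfFiniteType.isLocallyNoetherian (Limits.pullback.fst f.left g.left ≫ C.hom)
  haveI : IsNoetherian (Limits.pullback f.left g.left) := ⟨⟩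
  infer_instance

namespace Jacobian

variable {C : SchemeOver ℂ}

/-- **`(f^P)_* π₁(C(ℂ), P)` has finite index in `π₁(J(ℂ))`** for a smooth projective curve `C/ℂ`, any
Jacobian `𝒥` of `C` and any `P ∈ C(ℂ)` (Lange 2023, §4.1.1: `α_{c*} : H₁(C, ℤ) → H₁(J, ℤ)` is onto;
here from the universal property, see the module docstring).
[cite: Lange2023AbelianVarietiesC, §4.1.1 and Lemma 4.4.1 (proof)] -/
theorem index_range_map_abelJacobi_ne_zero (hC : IsSmoothProjective 1 C) (𝒥 : Jacobian C)
    (P : AlgPoints C ℂ) :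
    (FundamentalGroup.map (AlgPoints.mapContinuous (L := ℂ) (𝒥.abelJacobi P)) P).range.index ≠ 0 := by
  classical
  -- instances on `C` and `C(ℂ)`
  haveI : IsProper C.hom := IsSmoothProjective.isProper_holds hC
  haveI : ConnectedSpace (ComplexPoints C) :=
    Literature.AlgebraicGeometry.HodgeTheory.connectedSpace_complexPoints hC
  haveI : LocallyPathConnectedSpace (ComplexPoints C) := hC.locallyPathConnectedSpace
  haveI : PathConnectedSpace (ComplexPoints C) := hC.pathConnectedSpace
  haveI : Nonempty (ComplexPoints C) := ⟨P⟩
  -- notation: `J`, `f = f^P`, base point `f P = 1`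
  set J := 𝒥.J with hJ
  set fC : C(ComplexPoints C, J.Points ℂ) := AlgPoints.mapContinuous (L := ℂ) (𝒥.abelJacobi P) with hfC
  have hf1 : fC P = 1 := 𝒥.point_comp_abelJacobi P
  rw [← index_range_mapOfEq fC hf1]
  set M : Subgroup (FundamentalGroup (J.Points ℂ) (1 : J.Points ℂ)) :=
    (FundamentalGroup.mapOfEq fC hf1).range with hM
  -- the covering `x ↦ x²` of `J(ℂ)` and its monodromy `χ`; `S = χ(M) ⊆ J[2](ℂ)`
  have hpow := J.pow_surjective 2 two_ne_zero
  have hfin := J.finite_ker_powMonoidHom 2 two_ne_zero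
  have hpn : IsQuotientCoveringMap (powMonoidHom 2 : J.Points ℂ →* J.Points ℂ)
      (powMonoidHom 2 : J.Points ℂ →* J.Points ℂ).ker := isQuotientCoveringMap_pow 2 hpow hfin
  set χ := hpn.fundamentalGroupToMulOpposite ⟨1, one_mem_preimage_pow 2⟩ with hχ
  set K : Subgroup (powMonoidHom 2 : J.Points ℂ →* J.Points ℂ).ker := (M.map χ).unop with hK
  set S : Subgroup (J.Points ℂ) := K.map (powMonoidHom 2 : J.Points ℂ →* J.Points ℂ).ker.subtype
    with hSdef
  have hS : S ≤ J.torsionPoints ℂ ((2 : ℕ) : ℤ) := by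
    rintro _ ⟨y, -, rfl⟩
    rw [← AbelianVariety.ker_powMonoidHom_eq_torsionPoints]
    exact y.2
  haveI : Finite S := J.finite_of_le_torsionPoints two_ne_zero hS
  haveI : IsFinite (AbelianVariety.Hom.toSchemeHom (((2 : ℕ) : ℤ) • 𝟙 J)) :=
    J.isFinite_toSchemeHom_zsmul_id two_ne_zero
  haveI : IsAffineHom (AbelianVariety.Hom.toSchemeHom (((2 : ℕ) : ℤ) • 𝟙 J)) := inferInstance
  -- the quotient `J'' = J/S` and `h : J → J''`
  set J'' : AbelianVariety ℂ := J.quot ℂ S (J.smul_mem_of_algEquiv_self S) (((2 : ℕ) : ℤ) • 𝟙 J)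
    (J.comp_zsmul_id_eq_one_of_le_torsionPoints hS) (J.isFinite_toSchemeHom_zsmul_id two_ne_zero)
    with hJ''
  set h : J ⟶ J'' := J.quotHom ℂ S (J.smul_mem_of_algEquiv_self S) (((2 : ℕ) : ℤ) • 𝟙 J)
    (J.comp_zsmul_id_eq_one_of_le_torsionPoints hS) (J.isFinite_toSchemeHom_zsmul_id two_ne_zero)
    with hh
  set hCm : J.Points ℂ →* J''.Points ℂ := IsMonHom.monoidHom h.hom.hom.hom (specOver ℂ ℂ) with hhCm
  have hker : hCm.ker = S := J.ker_monoidHom_quotHom two_ne_zero S hS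
  have hsurj : Surjective hCm := J.surjective_monoidHom_quotHom two_ne_zero S hS
  have hhC : Continuous hCm := J.continuous_monoidHom h
  have hfinker : (hCm.ker : Set (J.Points ℂ)).Finite := by rw [hker]; exact Set.toFinite _
  have hpow'' := J''.pow_surjective 2 two_ne_zero
  have hfin'' := J''.finite_ker_powMonoidHom 2 two_ne_zero
  -- `h_*(M) ⊆ squares of π₁(J''(ℂ), 1)` (monodromy)
  have hMker : ∀ m ∈ M, ((χ m).unop : J.Points ℂ) ∈ hCm.ker := fun m hm => by
    rw [hker]
    exact ⟨(χ m).unop, Subgroup.mem_unop.mpr (Subgroup.mem_map_of_mem χ hm), rfl⟩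
  have hle := map_mapOfEq_le_range_powMap hCm 2 hhC hpow hfin hpow'' hfin'' M hMker
  -- `Φ = h ∘ f` and the lifting criterion for the covering `x ↦ x²` of `J''(ℂ)`
  set Φ : C(ComplexPoints C, J''.Points ℂ) := (⟨hCm, hhC⟩ : C(J.Points ℂ, J''.Points ℂ)).comp fC with hΦ
  have hΦ1 : Φ P = 1 := by
    change hCm (fC P) = 1
    rw [hf1, map_one]
  have hrange1 : (FundamentalGroup.mapOfEq Φ hΦ1).range ≤
      (FundamentalGroup.mapOfEq (powMap (J''.Points ℂ) 2) (powMap_one 2)).range := by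
    have := mapOfEq_comp_eq fC (⟨hCm, hhC⟩ : C(J.Points ℂ, J''.Points ℂ)) hf1 (map_one hCm)
    rw [show FundamentalGroup.mapOfEq Φ hΦ1 = FundamentalGroup.mapOfEq
      ((⟨hCm, hhC⟩ : C(J.Points ℂ, J''.Points ℂ)).comp fC) _ from rfl, this, ← MonoidHom.map_range]
    exact hle
  have hrange2 := range_map_le_range_mapOfEq Φ (powMap (J''.Points ℂ) 2) P hΦ1 (powMap_one 2) hrange1
  obtain ⟨F, ⟨hFP, hFlift⟩, -⟩ :=
    (J''.isCoveringMap_pow 2 two_ne_zero).existsUnique_continuousMap_lifts_of_range_le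
      (f := Φ) (a₀ := P) (e₀ := (1 : J''.Points ℂ))
      (show (1 : J''.Points ℂ) ^ 2 = Φ P by rw [hΦ1, one_pow]) hrange2
  -- algebraize the lift: `[2]_{J''}` is étale
  set q : J''.X ⟶ J''.X := ((((2 : ℕ) : ℤ) • 𝟙 J'' :) ).hom.hom.hom with hq
  haveI : Etale q.left := AbelianVariety.etale_zsmul_id_holds (A := J'') ((2 : ℕ) : ℤ) (by norm_num)
  haveI : IsFinite q.left := (J''.isFinite_toSchemeHom_zsmul_id two_ne_zero)
  haveI := noetherianSpace_pullback_of_isFinite (𝒥.abelJacobi P ≫ h.hom.hom.hom) q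
  have hqmap : (AlgPoints.map (L := ℂ) q : J''.Points ℂ → J''.Points ℂ) = fun y => y ^ 2 := by
    funext y
    rw [hq, AbelianVariety.map_zsmul_id_apply, zpow_natCast]
  have hloc : IsLocallyInjective (AlgPoints.map (L := ℂ) q) := by
    rw [hqmap]
    exact (J''.isCoveringMap_pow 2 two_ne_zero).isLocalHomeomorph.isLocallyInjective
  have hFq : ∀ x, AlgPoints.map q (F x) = AlgPoints.map (𝒥.abelJacobi P ≫ h.hom.hom.hom) x := by
    intro x
    rw [hqmap, AlgPoints.map_comp_apply]
    change ((fun y : J''.Points ℂ => y ^ 2) ∘ F) x = hCm (fC x)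
    rw [hFlift]
    rfl
  obtain ⟨e, he, hemap⟩ := exists_hom_comp_eq_and_map_eq (𝒥.abelJacobi P ≫ h.hom.hom.hom) q hloc F hFq
  -- the universal property: `e = ψ ∘ f`, `[2] ∘ ψ = h`
  have he1 : P ≫ e = 1 := (hemap P).trans hFP
  set ψ := 𝒥.descPointed P e he1 with hψ
  have hψq : ψ ≫ (((2 : ℕ) : ℤ) • 𝟙 J'') = h := by
    apply 𝒥.hom_ext_abelJacobi P
    change 𝒥.abelJacobi P ≫ ψ.hom.hom.hom ≫ q = 𝒥.abelJacobi P ≫ h.hom.hom.hom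
    rw [← Category.assoc, 𝒥.abelJacobi_descPointed P e he1, he]
  -- on `π₁`: `h_* = ([2] ∘ ψ)_* ⊆ squares`
  set ψC : J.Points ℂ →* J''.Points ℂ := IsMonHom.monoidHom ψ.hom.hom.hom (specOver ℂ ℂ) with hψC
  have hψcont : Continuous ψC := J.continuous_monoidHom ψ
  have hfactor : (⟨hCm, hhC⟩ : C(J.Points ℂ, J''.Points ℂ)) =
      (powMap (J''.Points ℂ) 2).comp ⟨ψC, hψcont⟩ := by
    refine ContinuousMap.ext fun x => ?_
    change hCm x = (ψC x) ^ 2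
    rw [hhCm, ← hψq, AbelianVariety.monoidHom_comp_apply, AbelianVariety.monoidHom_zsmul_id_apply]
  have hle2 : (FundamentalGroup.mapOfEq (⟨hCm, hhC⟩ : C(J.Points ℂ, J''.Points ℂ)) (map_one hCm)).range ≤
      (FundamentalGroup.mapOfEq (powMap (J''.Points ℂ) 2) (powMap_one 2)).range := by
    rw [range_mapOfEq_congr hfactor, show FundamentalGroup.mapOfEq ((powMap (J''.Points ℂ) 2).comp
      ⟨ψC, hψcont⟩) (hfactor ▸ map_one hCm) = FundamentalGroup.mapOfEq _ _ from rfl,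
      mapOfEq_comp_eq ⟨ψC, hψcont⟩ (powMap (J''.Points ℂ) 2) (map_one ψC) (powMap_one 2)]
    rintro _ ⟨y, rfl⟩
    exact ⟨_, rfl⟩
  -- indices and cardinalities
  have hidx1 := index_range_mapOfEq_monoidHom_eq_natCard_ker hCm hhC hsurj hfinker
  have hidx2 := J''.index_range_powMap_eq_natCard_torsionPoints 2 two_ne_zero
  have hdvd : Nat.card (J''.torsionPoints ℂ ((2 : ℕ) : ℤ)) ∣ Nat.card S := by
    rw [← hidx2, ← hker, ← hidx1]
    exact Subgroup.index_dvd_of_le hle2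
  have hb : Module.finrank ℤ (singularHomology ℤ ℤ (J.Points ℂ) 1) ≤
      Module.finrank ℤ (singularHomology ℤ ℤ (J''.Points ℂ) 1) := by
    haveI := J''.finite_singularHomology 1
    exact LinearMap.finrank_le_finrank_of_injective
      (f := (singularHomology.map ℤ ℤ (⟨hCm, hhC⟩ : C(J.Points ℂ, J''.Points ℂ)) 1).hom)
      (singularHomology_map_one_injective hCm hhC hsurj hfinker)
  haveI : Finite (J.torsionPoints ℂ ((2 : ℕ) : ℤ)) :=
    AbelianVariety.finite_torsionPoints_of_cast_ne_zero J ℂ ((2 : ℕ) : ℤ) (by norm_num)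
  have hcardS : Nat.card S ≤ Nat.card (J.torsionPoints ℂ ((2 : ℕ) : ℤ)) := Subgroup.card_le_of_le hS
  have hcJ := J.natCard_torsionPoints_eq_pow_finrank_int 2 two_ne_zero
  have hcJ'' := J''.natCard_torsionPoints_eq_pow_finrank_int 2 two_ne_zero
  have hSpos : 0 < Nat.card S := Nat.card_pos
  have hcard : Nat.card (J.torsionPoints ℂ ((2 : ℕ) : ℤ)) ≤ Nat.card S :=
    calc Nat.card (J.torsionPoints ℂ ((2 : ℕ) : ℤ)) = 2 ^ _ := hcJ
      _ ≤ 2 ^ _ := Nat.pow_le_pow_right (by norm_num) hb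
      _ = Nat.card (J''.torsionPoints ℂ ((2 : ℕ) : ℤ)) := hcJ''.symm
      _ ≤ Nat.card S := Nat.le_of_dvd hSpos hdvd
  have hSeq : S = J.torsionPoints ℂ ((2 : ℕ) : ℤ) := Subgroup.eq_of_le_of_card_ge hS hcard
  -- `χ(M)` is all of `J[2](ℂ)`: every `g ∈ Λ` is `m · y²` with `m ∈ M`
  have hKtop : K = ⊤ := by
    rw [eq_top_iff]
    rintro y -
    have hy : (y : J.Points ℂ) ∈ S := by
      rw [hSeq, ← AbelianVariety.ker_powMonoidHom_eq_torsionPoints]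
      exact y.2
    obtain ⟨y', hy', hyy'⟩ := hy
    rwa [← Subtype.ext hyy']
  have hdecomp : ∀ g : FundamentalGroup (J.Points ℂ) (1 : J.Points ℂ),
      ∃ m ∈ M, ∃ y, g = m * y ^ 2 := by
    intro g
    have hg : χ g ∈ M.map χ := by
      rw [← Subgroup.op_unop (M.map χ), Subgroup.mem_op, ← hK, hKtop]
      trivial
    obtain ⟨m, hm, hmg⟩ := hg
    have hk : m⁻¹ * g ∈ χ.ker := by
      rw [MonoidHom.mem_ker, map_mul, map_inv, hmg, inv_mul_cancel]
    rw [hpn.ker_fundamentalGroupToMulOpposite, hpn.ker_monodromyPerm ⟨1, one_mem_preimage_pow 2⟩] at hk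
    obtain ⟨yq, hyq⟩ := hk
    have hyq' : yq ^ 2 = m⁻¹ * g := by
      rw [← mapOfEq_powMap 2 yq, ← hyq]
      rfl
    exact ⟨m, hm, yq, by rw [hyq', mul_inv_cancel_left]⟩
  -- `Λ ≅ H₁(J(ℂ); ℤ)` is finitely generated: conclude
  haveI : AddGroup.FG (singularHomology ℤ ℤ (J.Points ℂ) 1) := by
    have hfg : Module.Finite ℤ (singularHomology ℤ ℤ (J.Points ℂ) 1) := J.finite_singularHomology 1
    have : @Module.Finite ℤ (singularHomology ℤ ℤ (J.Points ℂ) 1) _ _ (AddCommGroup.toIntModule _) := by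
      convert hfg
      exact Subsingleton.elim _ _
    exact Module.Finite.iff_addGroup_fg.mp this
  exact Subgroup.index_ne_zero_of_forall_exists_mul_sq
    (MulEquiv.ofBijective (hurewiczOne ℤ ℤ (1 : ℤ) (1 : J.Points ℂ)) J.bijective_hurewiczOne) M hdecomp

end Jacobian

/-! ### The named fact, reduced to `b₁(C) ≤ b₁(J)` -/

/-- **`isIso_bettiCohomology_map_abelJacobi` follows from `b₁(C(ℂ)) ≤ b₁(J(ℂ))`** for the Jacobians of
smooth projective curves over `ℂ` (finite index of `(f^P)_* π₁`, `index_range_map_abelJacobi_ne_zero`,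
fed into `isIso_bettiCohomology_map_abelJacobi_of_index_of_finrank`).
[cite: Lange2023AbelianVarietiesC, §4.1.1 and Lemma 4.4.1 (proof)] -/
theorem isIso_bettiCohomology_map_abelJacobi_of_finrank_le
    (h : ∀ (C : SchemeOver ℂ), IsSmoothProjective 1 C → ∀ (𝒥 : Jacobian C),
      Module.finrank ℚ (bettiCohomology C 1) ≤ Module.finrank ℚ (bettiCohomology 𝒥.J.X 1)) :
    isIso_bettiCohomology_map_abelJacobi :=
  isIso_bettiCohomology_map_abelJacobi_of_index_of_finrank fun C hC ⟨𝒥⟩ ⟨P⟩ =>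
    ⟨𝒥, P, Jacobian.index_range_map_abelJacobi_ne_zero hC 𝒥 P, h C hC 𝒥⟩

/-- **`isIso_bettiCohomology_map_abelJacobi` from `dim J = g` and the count of torsion points**: the
named facts `two_mul_dim_eq_finrank_bettiCohomology` (`2 dim J = b₁(C(ℂ))`, Milne Prop. 2.1) and
`AbelianVariety.natCard_torsionPoints_of_isAlgClosed` for the Jacobians over `ℂ` (`|J[n](ℂ)| = n^{2 dim J}`,
Mumford §6 App. 3) give `b₁(C) = 2 dim J = b₁(J)` (`finrank_bettiCohomology_one_eq_of_natCard_torsionPoints`),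
hence the fact. [cite: Lange2023AbelianVarietiesC, §4.1.1 and Lemma 4.4.1 (proof)] -/
theorem isIso_bettiCohomology_map_abelJacobi_of_facts (h₁ : two_mul_dim_eq_finrank_bettiCohomology)
    (h₂ : ∀ (C : SchemeOver ℂ) (𝒥 : Jacobian C), AbelianVariety.natCard_torsionPoints_of_isAlgClosed 𝒥.J ℂ) :
    isIso_bettiCohomology_map_abelJacobi :=
  isIso_bettiCohomology_map_abelJacobi_of_finrank_le fun C hC 𝒥 => by
    rw [← h₁ C hC 𝒥, 𝒥.J.finrank_bettiCohomology_one_eq_of_natCard_torsionPoints (h₂ C 𝒥)]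

end Literature.AlgebraicGeometry.Motives

end
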